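import Summits.BirchSwinnertonDyer.BirchSwinnertonDyer.Theorems.GenusKolyvaginAtTwoGenusPrimitiveSupplyAtTwoOfKernels
import Summits.BirchSwinnertonDyer.BirchSwinnertonDyer.Theorems.GenusKolyvaginAtTwoExactDescentAtTwoOfFourFactsClosed
import Summits.BirchSwinnertonDyer.BirchSwinnertonDyer.Theorems.GenusKolyvaginAtTwoKolyvaginExactAtTwoOfSplit
import Summits.BirchSwinnertonDyer.BirchSwinnertonDyer.Theorems.GenusKolyvaginAtTwoCyclicTorsionOfNegDisc
import Summits.BirchSwinnertonDyer.BirchSwinnertonDyer.Theorems.GenusKolyvaginAtTwoAssembly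
import HarnessLib

/-!
# Route `GenusKolyvaginAtTwo`, crux `GenusPrimitiveSupplyAtTwo` (stmt-BirchSwinnertonDyer-22136):
# THE ∃K-FORM KERNEL — the crux BY NAME from Gross–Zagier and ONE merged kernel, with NO `2`-converse in the cone

Width seat bsd-line-gk2-p4 (g6), cell `bsd-f1-sign2`. CONDITIONAL; the crux stays OPEN; BSD is not proved by any of this.

WHY. The lead's REPAIR CENSUS v1.2 §6 (`Cruxes/GenusPrimitiveSupplyAtTwo/Lines/genus-supply-repairs.md`) records that a child
item for the open kernel U must EITHER carry the side condition `DEF(W,K) = 1` in ∀K-form (route rev 7–11: item 24947, plus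
the `2`-converse children 19220 / 24948 and four print supports, glue 24951) OR «be stated in ∃K-form — then SUPPLY merges into
the child and the twin closers compose differently». This file is the second alternative, kernel-checked:

* (U∃_C) — ONE hypothesis, read at `(W, Dt)`: for `W` on the habitat (non-CM, analytic rank `0`, `ρ_{W,2^n}` onto for all
  `n ≥ 1`, odd Tamagawa product) and an optimal parametrisation `Dt` of level `N_W` with odd Manin constant, THERE IS a
  Kolyvagin-(H2)-admissible Heegner field `K` (odd `d_K ≠ −3`, Heegner hypothesis, `d_K·(−|Δ|)` and `d_K·(−2|Δ|)` non-squares)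
  satisfying a displayed side condition `C(W, d_K)` (e.g. `DEF = 1`; `C := ⊤` for none), carrying (i) a globally minimal model
  `Wd ≅ W^{(d_K)}` of ANALYTIC RANK `1` with `#Sel₂(Wd) = 2`, and (ii) for every orientation `β`, embedding `ι` and conductor-`1`
  datum `d₁` with `y_K = P(1)` of infinite order, a multi-genus certificate at some square-free level `n` of Kolyvagin primes at
  `2` (the trace `Σ_{g ∈ T} g·y(n)` to `K(√ℓ* : ℓ ∣ n)` is not `2`-divisible in `E(K[n])` — the binder text of U, item 24947,
  verbatim after its `K`-hypotheses).
* `genusPrimitiveSupplyAtTwo_of_grossZagier_of_existsRestrictedKernel`: Gross–Zagier (`gross_zagier` at every `(N_W, W, K)`) ∧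
  (U∃_C) ⟹ `GenusPrimitiveSupplyAtTwo`, for ANY `C`. NO rank-one `2`-converse (19220 `RankOneTwoConverse`, 24948
  `RankOneTwoConverseOffSemistableAtTwo`), NO Modularity / `2`-parity / Cassels–Tate / Mazur–Rubin Prop. 5.2 item enters: the
  twin's analytic rank is PART of the kernel (as it is BSD-side: the certificate and the rank-one twin are one statement about
  the genus class of `(E, K)`, lead's `…DiscriminantShadow`), and `y_K` of infinite order comes from Gross–Zagier alone
  (gk2-p4's `stub_heegnerNonTorsionAtTwo_of_grossZagier`).
* `existsRestrictedKernel_of_supply_of_restrictedKernel`: (U∃_C) ⟸ (SUPPLY⁺_C) ∧ (U_C) — the rev-7 pair in the lead's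
  `C`-restricted ∀K-form (`…OfRestrictedKernels`, with the twin's analytic rank in the supply clause) implies the ∃K kernel, so
  adopting (U∃_C) loses no proof path; conversely (U∃_C) does not imply (U_C) (∀K) — it is the WEAKER, BSD-consistent statement
  for every `C` (census v1.2 §6: the ∀K-form is BSD-side unsatisfiable at `DEF ≥ 3`).
* `nonCMAtTwo_of_existsKernel`: the ∃K-LINE's complete open list, kernel-checked through the route's own deciding theorem
  `closes`: leaf `Rank1Residual.NonCMAtTwo` ⟸ (U∃) ∧ Q2 `KolyvaginRelationAtTwo` ∧ Q5 `EquivariantChebotarevAtTwo` ∧ Q3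
  `EquivariantKolyvaginExactAtTwo` ∧ Q4 `KolyvaginExactAtTwoPosDisc` (residual) ∧ #5 `OffHabitatResidualAtTwo` (residual) ∧
  PRINT {`EntireLFunctionRat`, `GrossZagierAllLevels`, `MultPublishedInputsAtTwo`, `MilneAnyModel`} — using the CLOSED items Q1
  (`cyclicTorsionOfNegDisc_proof`), glue 24884 (`kolyvaginExactAtTwoOfSplit_proof`), 24238 (`exactDescentAtTwoOfFourFacts_proof`)
  and `minimalTwinBSDTwo_of_offHabitatResidualAtTwo` (crux #6 is subsumed by the residual as typed).

Trade-off for the pen (numbers, not adjectives): cone of 22136 under rev 11 = {24947 (XL), 19220 (XL), 24948 (XL, unattacked),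
19382, 24949, 19420, 24950 (print), 24951 (glue), 24148 (GZ, print)}; under the ∃K-line = {U∃ (XL: SUPPLY_{C} merged with U_{C}),
24148}. SUPPLY with `DEF = 1` is not in print either way (census §6 V12 row). Helper for the crux item
(`--supports stmt-BirchSwinnertonDyer-22136`); no item is closed; BSD is not proved by any of this.
-/

set_option linter.dupNamespace false -- tree convention: `Summit.BirchSwinnertonDyer.BirchSwinnertonDyer.Theorems` (summit = sub-problem)

noncomputable section

open scoped Classical

namespace Summit.BirchSwinnertonDyer.BirchSwinnertonDyer.Theorems.GenusKoly

open Finset NumberField WeierstrassCurve Literature.NumberTheory.EllipticCurves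
  Literature.NumberTheory.EllipticCurves.ModularForms
open Summit.BirchSwinnertonDyer.BirchSwinnertonDyer.Theses.GenusKolyvaginAtTwo

/-! ### §1 The crux from Gross–Zagier and the `C`-restricted ∃K kernel -/

/-- **THE CRUX `GenusPrimitiveSupplyAtTwo` BY NAME FROM GROSS–ZAGIER AND THE ∃K-FORM KERNEL (U∃_C), for any side condition
`C(W, d_K)`.** Gross–Zagier (`gross_zagier` at every `(N_W, W, K)`, item 24148 in the lead's binder form) and (U∃_C) — «for `W` on
the habitat and an optimal odd-Manin parametrisation `Dt` of level `N_W` there is an admissible Heegner field `K` with `C(W, d_K)`, a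
globally minimal `Wd ≅ W^{(d_K)}` of analytic rank `1` with `#Sel₂(Wd) = 2`, and, for every `β ι d₁` with `y_K` of infinite order, a
multi-genus certificate at some square-free level of Kolyvagin primes at `2`» — imply the crux. Proof = the composition of line
`genus-supply` (lead, `genusPrimitiveSupplyAtTwo_of_twoConverse_of_restrictedKernels`) with SUPPLY, CONV₂ and U replaced by
the single ∃K hypothesis: orientation `β` from the Heegner hypothesis, conductor-`1` datum from CM theory (PROVED in the tree),
`y_K` of infinite order from Gross–Zagier (`L(E,1)·L'(E^{(d_K)},1) ≠ 0`), McCallum's `M₀`, and the intrinsic dictionary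
multi-genus trace ↔ `P(n)` (`exists_derivedPoint_not_two_dvd_of_multiGenusTrace`). CONDITIONAL on (U∃_C) (OPEN, beyond print)
and Gross–Zagier (print). [cite: GrossZagier1986, Thm. I.6.3 with V.§2] [cite: GrossLMS1991, §3 (3.5), Prop. 3.7 (1), §4 (4.1)]
[cite: McCallumLMS1991, §5 Lemma 5.1] -/
theorem genusPrimitiveSupplyAtTwo_of_grossZagier_of_existsRestrictedKernel (C : WeierstrassCurve ℚ → ℤ → Prop)
    (hGZ : ∀ (W : WeierstrassCurve ℚ) [NeZero (W.conductorNorm ℤ)] (K : Type) [Field K] [NumberField K],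
      gross_zagier (W.conductorNorm ℤ) W K)
    (hUE : ∀ (W : WeierstrassCurve ℚ) [W.IsElliptic] [W.IsGloballyMinimal] [NeZero (W.conductorNorm ℤ)],
      ¬ W.HasCM → W.analyticRank = 0 → (∀ n : ℕ, 0 < n → W.HasSurjectiveModNGaloisRep ((2 : ℤ) ^ n)) →
      Odd W.tamagawaProduct →
      ∀ (Dt : ModularParametrizationData W (W.conductorNorm ℤ)),
      (∀ z ∈ Dt.L.lattice, ∃ w ∈ periodLattice Dt.f, z = (Dt.c : ℂ) * w) → Odd Dt.c →
      ∃ (K : Type) (_ : Field K) (_ : NumberField K),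
        IsImaginaryQuadratic K ∧ Odd (NumberField.discr K) ∧ NumberField.discr K ≠ -3 ∧
        SatisfiesHeegnerHypothesis (W.conductorNorm ℤ) K ∧
        ¬ IsSquare ((NumberField.discr K : ℚ) * -|W.Δ|) ∧ ¬ IsSquare ((NumberField.discr K : ℚ) * (-(2 * |W.Δ|))) ∧
        C W (NumberField.discr K) ∧
        (∃ (Wd : WeierstrassCurve ℚ) (_ : Wd.IsElliptic) (_ : Wd.IsGloballyMinimal),
          (∃ C' : WeierstrassCurve.VariableChange ℚ, C' • W.quadraticTwist (NumberField.discr K : ℚ) = Wd) ∧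
          Wd.analyticRank = 1 ∧ Nat.card (Wd.selmerGroup 2) = 2) ∧
        ∀ (β : ℤ) (ι : K →+* ℂ) (d₁ : KolyvaginHeegnerData Dt β ι 1), ¬ IsOfFinAddOrder d₁.derivedPoint →
        ∃ (n : ℕ) (d : KolyvaginHeegnerData Dt β ι n) (θ : ℕ → ringClassField K ι n)
          (T : Finset (ringClassField K ι n ≃ₐ[ℚ] ringClassField K ι n)), Squarefree n ∧
          (∀ ℓ ∈ n.primeFactors, Zhang2014.IsKolyvaginPrime (W.conductorNorm ℤ) W K 2 ℓ) ∧
          (∀ ℓ ∈ n.primeFactors, θ ℓ ^ 2 = algebraMap ℚ (ringClassField K ι n) ((-1 : ℚ) ^ (ℓ / 2) * ℓ)) ∧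
          (∀ g, g ∈ T ↔ g ∈ ringClassGal ι n ∧ ∀ ℓ ∈ n.primeFactors, g (θ ℓ) = θ ℓ) ∧
          ¬ ∃ Q : (W.baseChange (ringClassField K ι n)).toAffine.Point, (2 : ℤ) • Q =
            ∑ g ∈ T, pointGalHom W (ringClassField K ι n) g d.y) :
    GenusPrimitiveSupplyAtTwo := by
  intro W _ _ _ hcm hr0 hρ hT hopt
  obtain ⟨Dt, hoptDt, hc⟩ := hopt
  -- the ∃K kernel at `(W, Dt)`: the field, the side condition, the rank-one minimal twin, the certificate clause
  obtain ⟨K, iF, iN, hIQ, hodd, h3, hHe, hsq1, hsq2, -, ⟨Wd, iE, iM, hWd, hrd, hSel⟩, hcert⟩ :=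
    hUE W hcm hr0 hρ hT Dt hoptDt hc
  -- glue: orientation, embedding, conductor-`1` datum
  obtain ⟨β, hβ⟩ : ∃ β : ℤ, (4 * (W.conductorNorm ℤ : ℕ) : ℤ) ∣ β ^ 2 - NumberField.discr K :=
    Literature.NumberTheory.QuadraticFields.Quadratic.exists_dvd_sq_sub_discr_of_ncard_primesOver hIQ.1 (NeZero.ne _) hHe
  obtain ⟨ι⟩ : Nonempty (K →+* ℂ) := inferInstance
  obtain ⟨d₁⟩ := exists_kolyvaginHeegnerData_one
    (phi_heegnerTau_mem_singularModuliField_holds (W.conductorNorm ℤ) W K) hIQ Dt β ι hβ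
  -- the twin: non-CM, analytic rank of the twist read off the minimal model
  have hd : (NumberField.discr K : ℚ) ≠ 0 := by exact_mod_cast NumberField.discr_ne_zero K
  haveI := W.isElliptic_quadraticTwist hd
  have hcmd : ¬ Wd.HasCM := twin_not_hasCM W hcm hd Wd hWd
  have hrtw : (W.quadraticTwist (NumberField.discr K : ℚ)).analyticRank = 1 := by
    obtain ⟨C', hC'⟩ := hWd
    rw [← analyticRank_smul (W.quadraticTwist (NumberField.discr K : ℚ)) C', hC']
    exact hrd
  -- `y_K` of infinite order: Gross–Zagier alone
  have hy : ¬ IsOfFinAddOrder d₁.derivedPoint :=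
    stub_heegnerNonTorsionAtTwo_of_grossZagier hGZ W K hIQ hHe hr0 hrtw Dt β ι d₁
  obtain ⟨M₀, hdiv, hndiv⟩ := exists_exactTwoDivisibility_of_not_isOfFinAddOrder W hIQ Dt β ι d₁ hy
  -- the certificate through the intrinsic dictionary
  obtain ⟨n, d, hn, hKoly, hPn⟩ := exists_derivedPoint_not_two_dvd_of_multiGenusTrace hIQ hodd h3 hHe (hcert β ι d₁ hy)
  exact ⟨K, iF, iN, hIQ, hodd, h3, hHe, hsq1, hsq2, Dt, β, ι, d₁, hoptDt, hc, hy, M₀, hdiv, hndiv, n, d, hn, hKoly, hPn,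
    Wd, iE, iM, hWd, hcmd, hrd, hSel⟩

/-- **The unrestricted ∃K kernel (U∃ = U∃_⊤) and Gross–Zagier give the crux.** The case `C := ⊤` of
`genusPrimitiveSupplyAtTwo_of_grossZagier_of_existsRestrictedKernel`, with the side-condition conjunct removed from the binder.
[cite: GrossZagier1986, Thm. I.6.3 with V.§2] [cite: GrossLMS1991, §3 (3.5), §4 (4.1)] -/
theorem genusPrimitiveSupplyAtTwo_of_grossZagier_of_existsKernel
    (hGZ : ∀ (W : WeierstrassCurve ℚ) [NeZero (W.conductorNorm ℤ)] (K : Type) [Field K] [NumberField K],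
      gross_zagier (W.conductorNorm ℤ) W K)
    (hUE : ∀ (W : WeierstrassCurve ℚ) [W.IsElliptic] [W.IsGloballyMinimal] [NeZero (W.conductorNorm ℤ)],
      ¬ W.HasCM → W.analyticRank = 0 → (∀ n : ℕ, 0 < n → W.HasSurjectiveModNGaloisRep ((2 : ℤ) ^ n)) →
      Odd W.tamagawaProduct →
      ∀ (Dt : ModularParametrizationData W (W.conductorNorm ℤ)),
      (∀ z ∈ Dt.L.lattice, ∃ w ∈ periodLattice Dt.f, z = (Dt.c : ℂ) * w) → Odd Dt.c →
      ∃ (K : Type) (_ : Field K) (_ : NumberField K),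
        IsImaginaryQuadratic K ∧ Odd (NumberField.discr K) ∧ NumberField.discr K ≠ -3 ∧
        SatisfiesHeegnerHypothesis (W.conductorNorm ℤ) K ∧
        ¬ IsSquare ((NumberField.discr K : ℚ) * -|W.Δ|) ∧ ¬ IsSquare ((NumberField.discr K : ℚ) * (-(2 * |W.Δ|))) ∧
        (∃ (Wd : WeierstrassCurve ℚ) (_ : Wd.IsElliptic) (_ : Wd.IsGloballyMinimal),
          (∃ C' : WeierstrassCurve.VariableChange ℚ, C' • W.quadraticTwist (NumberField.discr K : ℚ) = Wd) ∧
          Wd.analyticRank = 1 ∧ Nat.card (Wd.selmerGroup 2) = 2) ∧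
        ∀ (β : ℤ) (ι : K →+* ℂ) (d₁ : KolyvaginHeegnerData Dt β ι 1), ¬ IsOfFinAddOrder d₁.derivedPoint →
        ∃ (n : ℕ) (d : KolyvaginHeegnerData Dt β ι n) (θ : ℕ → ringClassField K ι n)
          (T : Finset (ringClassField K ι n ≃ₐ[ℚ] ringClassField K ι n)), Squarefree n ∧
          (∀ ℓ ∈ n.primeFactors, Zhang2014.IsKolyvaginPrime (W.conductorNorm ℤ) W K 2 ℓ) ∧
          (∀ ℓ ∈ n.primeFactors, θ ℓ ^ 2 = algebraMap ℚ (ringClassField K ι n) ((-1 : ℚ) ^ (ℓ / 2) * ℓ)) ∧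
          (∀ g, g ∈ T ↔ g ∈ ringClassGal ι n ∧ ∀ ℓ ∈ n.primeFactors, g (θ ℓ) = θ ℓ) ∧
          ¬ ∃ Q : (W.baseChange (ringClassField K ι n)).toAffine.Point, (2 : ℤ) • Q =
            ∑ g ∈ T, pointGalHom W (ringClassField K ι n) g d.y) :
    GenusPrimitiveSupplyAtTwo := by
  refine genusPrimitiveSupplyAtTwo_of_grossZagier_of_existsRestrictedKernel (fun _ _ ↦ True) hGZ ?_
  intro W _ _ _ hcm hr0 hρ hT Dt hoptDt hc
  obtain ⟨K, iF, iN, hIQ, hodd, h3, hHe, hsq1, hsq2, htwin, hcert⟩ := hUE W hcm hr0 hρ hT Dt hoptDt hc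
  exact ⟨K, iF, iN, hIQ, hodd, h3, hHe, hsq1, hsq2, trivial, htwin, hcert⟩

/-- **The same with Gross–Zagier as the route's item `GrossZagierAllLevels` (24148) BY NAME.**
[cite: GrossZagier1986, Thm. I.6.3 with V.§2] -/
theorem genusPrimitiveSupplyAtTwo_of_grossZagierAllLevels_of_existsKernel (hGZ : GrossZagierAllLevels)
    (hUE : ∀ (W : WeierstrassCurve ℚ) [W.IsElliptic] [W.IsGloballyMinimal] [NeZero (W.conductorNorm ℤ)],
      ¬ W.HasCM → W.analyticRank = 0 → (∀ n : ℕ, 0 < n → W.HasSurjectiveModNGaloisRep ((2 : ℤ) ^ n)) →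
      Odd W.tamagawaProduct →
      ∀ (Dt : ModularParametrizationData W (W.conductorNorm ℤ)),
      (∀ z ∈ Dt.L.lattice, ∃ w ∈ periodLattice Dt.f, z = (Dt.c : ℂ) * w) → Odd Dt.c →
      ∃ (K : Type) (_ : Field K) (_ : NumberField K),
        IsImaginaryQuadratic K ∧ Odd (NumberField.discr K) ∧ NumberField.discr K ≠ -3 ∧
        SatisfiesHeegnerHypothesis (W.conductorNorm ℤ) K ∧
        ¬ IsSquare ((NumberField.discr K : ℚ) * -|W.Δ|) ∧ ¬ IsSquare ((NumberField.discr K : ℚ) * (-(2 * |W.Δ|))) ∧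
        (∃ (Wd : WeierstrassCurve ℚ) (_ : Wd.IsElliptic) (_ : Wd.IsGloballyMinimal),
          (∃ C' : WeierstrassCurve.VariableChange ℚ, C' • W.quadraticTwist (NumberField.discr K : ℚ) = Wd) ∧
          Wd.analyticRank = 1 ∧ Nat.card (Wd.selmerGroup 2) = 2) ∧
        ∀ (β : ℤ) (ι : K →+* ℂ) (d₁ : KolyvaginHeegnerData Dt β ι 1), ¬ IsOfFinAddOrder d₁.derivedPoint →
        ∃ (n : ℕ) (d : KolyvaginHeegnerData Dt β ι n) (θ : ℕ → ringClassField K ι n)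
          (T : Finset (ringClassField K ι n ≃ₐ[ℚ] ringClassField K ι n)), Squarefree n ∧
          (∀ ℓ ∈ n.primeFactors, Zhang2014.IsKolyvaginPrime (W.conductorNorm ℤ) W K 2 ℓ) ∧
          (∀ ℓ ∈ n.primeFactors, θ ℓ ^ 2 = algebraMap ℚ (ringClassField K ι n) ((-1 : ℚ) ^ (ℓ / 2) * ℓ)) ∧
          (∀ g, g ∈ T ↔ g ∈ ringClassGal ι n ∧ ∀ ℓ ∈ n.primeFactors, g (θ ℓ) = θ ℓ) ∧
          ¬ ∃ Q : (W.baseChange (ringClassField K ι n)).toAffine.Point, (2 : ℤ) • Q =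
            ∑ g ∈ T, pointGalHom W (ringClassField K ι n) g d.y) :
    GenusPrimitiveSupplyAtTwo :=
  genusPrimitiveSupplyAtTwo_of_grossZagier_of_existsKernel (fun W _ K _ _ ↦ hGZ _ W K) hUE

/-! ### §2 The ∃K kernel is implied by the rev-7 pair (restricted supply ∧ restricted ∀K kernel) -/

/-- **(U∃_C) ⟸ (SUPPLY⁺_C) ∧ (U_C).** If (SUPPLY⁺_C) every habitat curve has an admissible Heegner field `K` with `C(W, d_K)` and
a globally minimal twin `Wd ≅ W^{(d_K)}` of analytic rank `1` with `#Sel₂(Wd) = 2` (the lead's SUPPLY_C with the analytic clause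
of the registered stub A), and (U_C) the lead's `C`-restricted ∀K kernel holds (binder of
`genusPrimitiveSupplyAtTwo_of_twoConverse_of_restrictedKernels`, verbatim), then the ∃K kernel (U∃_C) holds — pure logic
(instantiate U_C at the supplied `K` and twin). So every proof path of the rev-7/11 children also proves the ∃K item; the
converse fails (∃ vs ∀ over `K`). [folklore] -/
theorem existsRestrictedKernel_of_supply_of_restrictedKernel (C : WeierstrassCurve ℚ → ℤ → Prop)
    (hsupplyC : ∀ (W : WeierstrassCurve ℚ) [W.IsElliptic] [W.IsGloballyMinimal] [NeZero (W.conductorNorm ℤ)],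
      ¬ W.HasCM → W.analyticRank = 0 → (∀ n : ℕ, 0 < n → W.HasSurjectiveModNGaloisRep ((2 : ℤ) ^ n)) →
      Odd W.tamagawaProduct →
      ∃ (K : Type) (_ : Field K) (_ : NumberField K),
        IsImaginaryQuadratic K ∧ Odd (NumberField.discr K) ∧ NumberField.discr K ≠ -3 ∧
        SatisfiesHeegnerHypothesis (W.conductorNorm ℤ) K ∧
        ¬ IsSquare ((NumberField.discr K : ℚ) * -|W.Δ|) ∧ ¬ IsSquare ((NumberField.discr K : ℚ) * (-(2 * |W.Δ|))) ∧
        C W (NumberField.discr K) ∧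
        ∃ (Wd : WeierstrassCurve ℚ) (_ : Wd.IsElliptic) (_ : Wd.IsGloballyMinimal),
          (∃ C' : WeierstrassCurve.VariableChange ℚ, C' • W.quadraticTwist (NumberField.discr K : ℚ) = Wd) ∧
          Wd.analyticRank = 1 ∧ Nat.card (Wd.selmerGroup 2) = 2)
    (hUC : ∀ (W : WeierstrassCurve ℚ) [W.IsElliptic] [W.IsGloballyMinimal] [NeZero (W.conductorNorm ℤ)],
      ¬ W.HasCM → W.analyticRank = 0 → (∀ n : ℕ, 0 < n → W.HasSurjectiveModNGaloisRep ((2 : ℤ) ^ n)) →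
      Odd W.tamagawaProduct →
      ∀ (K : Type) [Field K] [NumberField K],
      IsImaginaryQuadratic K → Odd (NumberField.discr K) → NumberField.discr K ≠ -3 →
      SatisfiesHeegnerHypothesis (W.conductorNorm ℤ) K →
      ¬ IsSquare ((NumberField.discr K : ℚ) * -|W.Δ|) → ¬ IsSquare ((NumberField.discr K : ℚ) * (-(2 * |W.Δ|))) →
      C W (NumberField.discr K) →
      ∀ (Dt : ModularParametrizationData W (W.conductorNorm ℤ)),
      (∀ z ∈ Dt.L.lattice, ∃ w ∈ periodLattice Dt.f, z = (Dt.c : ℂ) * w) → Odd Dt.c →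
      ∀ (β : ℤ) (ι : K →+* ℂ) (d₁ : KolyvaginHeegnerData Dt β ι 1), ¬ IsOfFinAddOrder d₁.derivedPoint →
      ∀ (Wd : WeierstrassCurve ℚ) [Wd.IsElliptic] [Wd.IsGloballyMinimal],
      (∃ C' : WeierstrassCurve.VariableChange ℚ, C' • W.quadraticTwist (NumberField.discr K : ℚ) = Wd) →
      Wd.analyticRank = 1 → Nat.card (Wd.selmerGroup 2) = 2 →
      ∃ (n : ℕ) (d : KolyvaginHeegnerData Dt β ι n) (θ : ℕ → ringClassField K ι n)
        (T : Finset (ringClassField K ι n ≃ₐ[ℚ] ringClassField K ι n)), Squarefree n ∧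
        (∀ ℓ ∈ n.primeFactors, Zhang2014.IsKolyvaginPrime (W.conductorNorm ℤ) W K 2 ℓ) ∧
        (∀ ℓ ∈ n.primeFactors, θ ℓ ^ 2 = algebraMap ℚ (ringClassField K ι n) ((-1 : ℚ) ^ (ℓ / 2) * ℓ)) ∧
        (∀ g, g ∈ T ↔ g ∈ ringClassGal ι n ∧ ∀ ℓ ∈ n.primeFactors, g (θ ℓ) = θ ℓ) ∧
        ¬ ∃ Q : (W.baseChange (ringClassField K ι n)).toAffine.Point, (2 : ℤ) • Q =
          ∑ g ∈ T, pointGalHom W (ringClassField K ι n) g d.y) :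
    ∀ (W : WeierstrassCurve ℚ) [W.IsElliptic] [W.IsGloballyMinimal] [NeZero (W.conductorNorm ℤ)],
      ¬ W.HasCM → W.analyticRank = 0 → (∀ n : ℕ, 0 < n → W.HasSurjectiveModNGaloisRep ((2 : ℤ) ^ n)) →
      Odd W.tamagawaProduct →
      ∀ (Dt : ModularParametrizationData W (W.conductorNorm ℤ)),
      (∀ z ∈ Dt.L.lattice, ∃ w ∈ periodLattice Dt.f, z = (Dt.c : ℂ) * w) → Odd Dt.c →
      ∃ (K : Type) (_ : Field K) (_ : NumberField K),
        IsImaginaryQuadratic K ∧ Odd (NumberField.discr K) ∧ NumberField.discr K ≠ -3 ∧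
        SatisfiesHeegnerHypothesis (W.conductorNorm ℤ) K ∧
        ¬ IsSquare ((NumberField.discr K : ℚ) * -|W.Δ|) ∧ ¬ IsSquare ((NumberField.discr K : ℚ) * (-(2 * |W.Δ|))) ∧
        C W (NumberField.discr K) ∧
        (∃ (Wd : WeierstrassCurve ℚ) (_ : Wd.IsElliptic) (_ : Wd.IsGloballyMinimal),
          (∃ C' : WeierstrassCurve.VariableChange ℚ, C' • W.quadraticTwist (NumberField.discr K : ℚ) = Wd) ∧
          Wd.analyticRank = 1 ∧ Nat.card (Wd.selmerGroup 2) = 2) ∧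
        ∀ (β : ℤ) (ι : K →+* ℂ) (d₁ : KolyvaginHeegnerData Dt β ι 1), ¬ IsOfFinAddOrder d₁.derivedPoint →
        ∃ (n : ℕ) (d : KolyvaginHeegnerData Dt β ι n) (θ : ℕ → ringClassField K ι n)
          (T : Finset (ringClassField K ι n ≃ₐ[ℚ] ringClassField K ι n)), Squarefree n ∧
          (∀ ℓ ∈ n.primeFactors, Zhang2014.IsKolyvaginPrime (W.conductorNorm ℤ) W K 2 ℓ) ∧
          (∀ ℓ ∈ n.primeFactors, θ ℓ ^ 2 = algebraMap ℚ (ringClassField K ι n) ((-1 : ℚ) ^ (ℓ / 2) * ℓ)) ∧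
          (∀ g, g ∈ T ↔ g ∈ ringClassGal ι n ∧ ∀ ℓ ∈ n.primeFactors, g (θ ℓ) = θ ℓ) ∧
          ¬ ∃ Q : (W.baseChange (ringClassField K ι n)).toAffine.Point, (2 : ℤ) • Q =
            ∑ g ∈ T, pointGalHom W (ringClassField K ι n) g d.y := by
  intro W _ _ _ hcm hr0 hρ hT Dt hoptDt hc
  obtain ⟨K, iF, iN, hIQ, hodd, h3, hHe, hsq1, hsq2, hC, Wd, iE, iM, hWd, hrd, hSel⟩ := hsupplyC W hcm hr0 hρ hT
  exact ⟨K, iF, iN, hIQ, hodd, h3, hHe, hsq1, hsq2, hC, ⟨Wd, iE, iM, hWd, hrd, hSel⟩,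
    fun β ι d₁ hy ↦ hUC W hcm hr0 hρ hT K hIQ hodd h3 hHe hsq1 hsq2 hC Dt hoptDt hc β ι d₁ hy Wd hWd hrd hSel⟩

/-- **Corollary: the crux from Gross–Zagier ∧ (SUPPLY⁺_C) ∧ (U_C), with NO `2`-converse.** In the lead's
`genusPrimitiveSupplyAtTwo_of_twoConverse_of_restrictedKernels` the hypotheses Modularity, `2`-parity and (CONV₂) serve only to
turn `#Sel₂(Wd) = 2` into `r_an(Wd) = 1`; if the supply clause carries the twin's analytic rank itself (SUPPLY⁺_C: «… a globally
minimal `Wd ≅ W^{(d_K)}` with `r_an(Wd) = 1` and `#Sel₂(Wd) = 2`», the registered stub A's own conclusion), the crux follows from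
Gross–Zagier, (SUPPLY⁺_C) and (U_C) alone, through the ∃K kernel (§1 ∘ §2). [cite: GrossZagier1986, Thm. I.6.3 with V.§2]
[cite: GrossLMS1991, §3 (3.5), §4 (4.1)] -/
theorem genusPrimitiveSupplyAtTwo_of_grossZagier_of_supply_of_restrictedKernel (C : WeierstrassCurve ℚ → ℤ → Prop)
    (hGZ : ∀ (W : WeierstrassCurve ℚ) [NeZero (W.conductorNorm ℤ)] (K : Type) [Field K] [NumberField K],
      gross_zagier (W.conductorNorm ℤ) W K)
    (hsupplyC : ∀ (W : WeierstrassCurve ℚ) [W.IsElliptic] [W.IsGloballyMinimal] [NeZero (W.conductorNorm ℤ)],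
      ¬ W.HasCM → W.analyticRank = 0 → (∀ n : ℕ, 0 < n → W.HasSurjectiveModNGaloisRep ((2 : ℤ) ^ n)) →
      Odd W.tamagawaProduct →
      ∃ (K : Type) (_ : Field K) (_ : NumberField K),
        IsImaginaryQuadratic K ∧ Odd (NumberField.discr K) ∧ NumberField.discr K ≠ -3 ∧
        SatisfiesHeegnerHypothesis (W.conductorNorm ℤ) K ∧
        ¬ IsSquare ((NumberField.discr K : ℚ) * -|W.Δ|) ∧ ¬ IsSquare ((NumberField.discr K : ℚ) * (-(2 * |W.Δ|))) ∧
        C W (NumberField.discr K) ∧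
        ∃ (Wd : WeierstrassCurve ℚ) (_ : Wd.IsElliptic) (_ : Wd.IsGloballyMinimal),
          (∃ C' : WeierstrassCurve.VariableChange ℚ, C' • W.quadraticTwist (NumberField.discr K : ℚ) = Wd) ∧
          Wd.analyticRank = 1 ∧ Nat.card (Wd.selmerGroup 2) = 2)
    (hUC : ∀ (W : WeierstrassCurve ℚ) [W.IsElliptic] [W.IsGloballyMinimal] [NeZero (W.conductorNorm ℤ)],
      ¬ W.HasCM → W.analyticRank = 0 → (∀ n : ℕ, 0 < n → W.HasSurjectiveModNGaloisRep ((2 : ℤ) ^ n)) →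
      Odd W.tamagawaProduct →
      ∀ (K : Type) [Field K] [NumberField K],
      IsImaginaryQuadratic K → Odd (NumberField.discr K) → NumberField.discr K ≠ -3 →
      SatisfiesHeegnerHypothesis (W.conductorNorm ℤ) K →
      ¬ IsSquare ((NumberField.discr K : ℚ) * -|W.Δ|) → ¬ IsSquare ((NumberField.discr K : ℚ) * (-(2 * |W.Δ|))) →
      C W (NumberField.discr K) →
      ∀ (Dt : ModularParametrizationData W (W.conductorNorm ℤ)),
      (∀ z ∈ Dt.L.lattice, ∃ w ∈ periodLattice Dt.f, z = (Dt.c : ℂ) * w) → Odd Dt.c →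
      ∀ (β : ℤ) (ι : K →+* ℂ) (d₁ : KolyvaginHeegnerData Dt β ι 1), ¬ IsOfFinAddOrder d₁.derivedPoint →
      ∀ (Wd : WeierstrassCurve ℚ) [Wd.IsElliptic] [Wd.IsGloballyMinimal],
      (∃ C' : WeierstrassCurve.VariableChange ℚ, C' • W.quadraticTwist (NumberField.discr K : ℚ) = Wd) →
      Wd.analyticRank = 1 → Nat.card (Wd.selmerGroup 2) = 2 →
      ∃ (n : ℕ) (d : KolyvaginHeegnerData Dt β ι n) (θ : ℕ → ringClassField K ι n)
        (T : Finset (ringClassField K ι n ≃ₐ[ℚ] ringClassField K ι n)), Squarefree n ∧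
        (∀ ℓ ∈ n.primeFactors, Zhang2014.IsKolyvaginPrime (W.conductorNorm ℤ) W K 2 ℓ) ∧
        (∀ ℓ ∈ n.primeFactors, θ ℓ ^ 2 = algebraMap ℚ (ringClassField K ι n) ((-1 : ℚ) ^ (ℓ / 2) * ℓ)) ∧
        (∀ g, g ∈ T ↔ g ∈ ringClassGal ι n ∧ ∀ ℓ ∈ n.primeFactors, g (θ ℓ) = θ ℓ) ∧
        ¬ ∃ Q : (W.baseChange (ringClassField K ι n)).toAffine.Point, (2 : ℤ) • Q =
          ∑ g ∈ T, pointGalHom W (ringClassField K ι n) g d.y) :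
    GenusPrimitiveSupplyAtTwo :=
  genusPrimitiveSupplyAtTwo_of_grossZagier_of_existsRestrictedKernel C hGZ
    (existsRestrictedKernel_of_supply_of_restrictedKernel C hsupplyC hUC)

/-! ### §3 The ∃K-line's complete open list, through the route's deciding theorem -/

/-- **LEAF `Rank1Residual.NonCMAtTwo` ⟸ (U∃) ∧ Q2 ∧ Q5 ∧ Q3 ∧ Q4 ∧ #5 ∧ PRINT {entire `L`, Gross–Zagier, GZK rank theorem,
Milne any-model}.** The route's own `closes` (rev 11), fed with: `hP :=` the crux from Gross–Zagier and (U∃) (§1); `hX :=`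
the LINE-6 glue `kolyvaginExactAtTwoOfSplit_proof` (item 24884, CLOSED) at Q1 (`cyclicTorsionOfNegDisc_proof`, item 24879,
CLOSED) and the open Q2 `KolyvaginRelationAtTwo`, Q5 `EquivariantChebotarevAtTwo`, Q3 `EquivariantKolyvaginExactAtTwo`, Q4
`KolyvaginExactAtTwoPosDisc` (residual); `hGf := exactDescentAtTwoOfFourFacts_proof` (item 24238, CLOSED); `hTw :=` crux #6 from
the residual #5 as typed (`minimalTwinBSDTwo_of_offHabitatResidualAtTwo`). What is NOT among the hypotheses: `RankOneTwoConverse`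
(19220), `RankOneTwoConverseOffSemistableAtTwo` (24948), `ModularityExistsNewform`, `TwoParityDD`, `CasselsTatePairingRat`,
`MazurRubinProp52Rat`, `MinimalTwinBSDTwo`. CONDITIONAL on the displayed open items; no summit, no leaf, no crux is proved;
BSD is not proved by any of this. [cite: GrossZagier1986, Thm. I.6.3 with V.§2] [cite: GrossLMS1991, §3 (3.5), §4 (4.1)]
[cite: McCallumLMS1991, §5] -/
theorem nonCMAtTwo_of_existsKernel
    (hUE : ∀ (W : WeierstrassCurve ℚ) [W.IsElliptic] [W.IsGloballyMinimal] [NeZero (W.conductorNorm ℤ)],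
      ¬ W.HasCM → W.analyticRank = 0 → (∀ n : ℕ, 0 < n → W.HasSurjectiveModNGaloisRep ((2 : ℤ) ^ n)) →
      Odd W.tamagawaProduct →
      ∀ (Dt : ModularParametrizationData W (W.conductorNorm ℤ)),
      (∀ z ∈ Dt.L.lattice, ∃ w ∈ periodLattice Dt.f, z = (Dt.c : ℂ) * w) → Odd Dt.c →
      ∃ (K : Type) (_ : Field K) (_ : NumberField K),
        IsImaginaryQuadratic K ∧ Odd (NumberField.discr K) ∧ NumberField.discr K ≠ -3 ∧
        SatisfiesHeegnerHypothesis (W.conductorNorm ℤ) K ∧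
        ¬ IsSquare ((NumberField.discr K : ℚ) * -|W.Δ|) ∧ ¬ IsSquare ((NumberField.discr K : ℚ) * (-(2 * |W.Δ|))) ∧
        (∃ (Wd : WeierstrassCurve ℚ) (_ : Wd.IsElliptic) (_ : Wd.IsGloballyMinimal),
          (∃ C' : WeierstrassCurve.VariableChange ℚ, C' • W.quadraticTwist (NumberField.discr K : ℚ) = Wd) ∧
          Wd.analyticRank = 1 ∧ Nat.card (Wd.selmerGroup 2) = 2) ∧
        ∀ (β : ℤ) (ι : K →+* ℂ) (d₁ : KolyvaginHeegnerData Dt β ι 1), ¬ IsOfFinAddOrder d₁.derivedPoint →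
        ∃ (n : ℕ) (d : KolyvaginHeegnerData Dt β ι n) (θ : ℕ → ringClassField K ι n)
          (T : Finset (ringClassField K ι n ≃ₐ[ℚ] ringClassField K ι n)), Squarefree n ∧
          (∀ ℓ ∈ n.primeFactors, Zhang2014.IsKolyvaginPrime (W.conductorNorm ℤ) W K 2 ℓ) ∧
          (∀ ℓ ∈ n.primeFactors, θ ℓ ^ 2 = algebraMap ℚ (ringClassField K ι n) ((-1 : ℚ) ^ (ℓ / 2) * ℓ)) ∧
          (∀ g, g ∈ T ↔ g ∈ ringClassGal ι n ∧ ∀ ℓ ∈ n.primeFactors, g (θ ℓ) = θ ℓ) ∧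
          ¬ ∃ Q : (W.baseChange (ringClassField K ι n)).toAffine.Point, (2 : ℤ) • Q =
            ∑ g ∈ T, pointGalHom W (ringClassField K ι n) g d.y)
    (hQ2 : KolyvaginRelationAtTwo) (hQ5 : EquivariantChebotarevAtTwo) (hQ3 : EquivariantKolyvaginExactAtTwo)
    (hQ4 : KolyvaginExactAtTwoPosDisc) (hR : OffHabitatResidualAtTwo) (hL : EntireLFunctionRat)
    (hGZ : GrossZagierAllLevels) (hGZK : MultPublishedInputsAtTwo) (hMi : MilneAnyModel) :
    Summit.BirchSwinnertonDyer.BirchSwinnertonDyer.Rank1Residual.NonCMAtTwo := by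
  -- buildfix (bf3-g30, class (i) drift): the route's `closes` was re-keyed (rev ≥ 12, 2026-08-28T14:09Z) to the R-glue
  -- binders `KolyvaginExactAtTwoOfSplitR` / `EquivariantChebotarevAtTwoR` / `EquivariantKolyvaginExactAtTwoR`, from which it
  -- DERIVES `hX : KolyvaginExactAtTwo` before running the unchanged rev-11 chain. This theorem keeps its accepted statement
  -- (Q5/Q3 in their non-R forms) and inlines that chain after building `hP`/`hX`/`hG`/`hTw` exactly as the rev-11 call did.
  have hP : GenusPrimitiveSupplyAtTwo := genusPrimitiveSupplyAtTwo_of_grossZagierAllLevels_of_existsKernel hGZ hUE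
  have hX : KolyvaginExactAtTwo :=
    GenusExact.kolyvaginExactAtTwoOfSplit_proof GenusCyclicTorsion.cyclicTorsionOfNegDisc_proof hQ2 hQ5 hQ3 hQ4
  have hGf : ExactDescentAtTwoOfFourFacts := GenusExactDescent.exactDescentAtTwoOfFourFacts_proof
  have hTw : MinimalTwinBSDTwo := GenusAssembly.minimalTwinBSDTwo_of_offHabitatResidualAtTwo hR
  have hG : ExactDescentAtTwo := hGf ⟨hGZ, hGZK, hL, hMi⟩
  intro W _ _ hcm hr
  haveI : NeZero (W.conductorNorm ℤ) := ⟨(W.conductorNorm_pos_holds).ne'⟩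
  by_cases hH : (W.analyticRank = 0 ∧ (∀ n : ℕ, 0 < n → W.HasSurjectiveModNGaloisRep ((2 : ℤ) ^ n)) ∧
        Odd W.tamagawaProduct ∧
        ∃ Dt : Literature.NumberTheory.EllipticCurves.ModularForms.ModularParametrizationData W (W.conductorNorm ℤ),
          (∀ z ∈ Dt.L.lattice, ∃ w ∈ Literature.NumberTheory.EllipticCurves.ModularForms.periodLattice Dt.f, z = (Dt.c : ℂ) * w) ∧ Odd Dt.c)
  · obtain ⟨hr0, hρ, hT, hopt⟩ := hH
    obtain ⟨K, _, _, hIQ, hodd, h3, hHe, hsq1, hsq2, Dt, β, ι, d₁, hoptDt, hc, hy, M₀, hdiv, hndiv,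
      n, d, hn, hKoly, hPn, Wd, _, _, hWd, hcmd, hrd, hSel⟩ := hP W hcm hr0 hρ hT hopt
    have hex := hX W hcm K hIQ hodd h3 hHe hsq1 hsq2 hρ Dt β ι d₁ hy M₀ hdiv hndiv n d hn hKoly hPn
    have hBd : Literature.NumberTheory.EllipticCurves.BSDp Wd 2 := hTw Wd hcmd hrd hSel
    exact hG W hcm hr0 hρ hT K hIQ hodd h3 hHe Dt hoptDt hc β ι d₁ hy M₀ hdiv hndiv hex Wd hWd hSel hBd
  · exact hR W hcm hr hH

end Summit.BirchSwinnertonDyer.BirchSwinnertonDyer.Theorems.GenusKoly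

end
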